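import Literature.Probability.Percolation.QuadCrossingDualDecoupling
import Literature.Probability.Percolation.QuadCrossingRot
import HarnessLib

/-!
# Schramm–Smirnov Lemma 6.1, case (3), main regime, for tame pairs — product form

Topic `Probability/Percolation`; proofs file towards the named fact `SchrammSmirnov2011_lemma_6_1`
(`QuadCrossingContinuity.lean`; O. Schramm, S. Smirnov, *On the scaling limits of planar
percolation*, Ann. Probab. 39 (2011), arXiv:1101.5820, Lemma 6.1 and its proof, p. 23: "the proof in
case (3) is symmetric to that of case (2)").

The symmetry is made explicit: relabelling the sides (`Quad.rot`), condition (3) for `(Q, Q')` is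
condition (2) for `(rot Q, rot Q')`, and the bad event `⊞_Q ∖ ⊞_{Q'}` lies in
`{dual crossing of rot Q'} ∩ {open transversal crossing of rot Q}`
(`Quad.crossed_and_not_crossed_subset_dual_rot`, `Quad.exists_openCrossing_transversal_of_not_exists_path`).
The dual exploration (`QuadCrossingBottomCluster.lean`, `…Data.lean`, `QuadCrossingDualSeparatorArm.lean`,
`QuadCrossingDualDecoupling.lean`) then gives, exactly as the lowest-crossing exploration did in case
(2) (`QuadCrossingContinuityCaseTwoTame.lean`), the product-form estimate
`P(⊞_Q Δ ⊞_{Q'}) ≤ 2 (C K ρ / d₀(Q))^α · P(dual crossing of rot Q')`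
(`measureReal_symmDiff_le_mul_of_isPerturbationThree_of_tame`) in the regime `K ρ ≤ c d₀(Q)`,
`ρ < d₁(Q)`, under: lattice tameness of `[Q]` (edge segments meet it connectedly) and of `[Q']`
(edge pieces connected), the `K`-chord–arc property of the free side `∂₃Q'` at scale `ρ`, and a cut
parameter `ζ` on `∂₃Q'` below which points are far from `∂₀Q` and above which far from `∂₂Q` (the
analogue of Schramm–Smirnov's cut `σ₁ ∪ σ₃`; the two landing points are ordered automatically in the
dual picture: `Quad.topContact_le_one_sub_topContact_flip`).  Everything is proved; no named fact is
introduced.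

## References

* O. Schramm, S. Smirnov, Ann. Probab. 39 (2011) 1768–1814, arXiv:1101.5820, Lemma 6.1 and its
  proof. [SchrammSmirnov2011]
* G. Grimmett, *Percolation*, 2nd ed. (1999), §11.7–11.8 (RSW). [GrimmettPercolation1999]
-/

noncomputable section

open Set Metric Filter Function
open _root_.MeasureTheory _root_.Topology
open scoped ENNReal symmDiff unitInterval
open Literature.Probability.LatticeModels
open Literature.Topology.PlaneTopology

namespace Literature.Probability.Percolation

namespace QuadCrossing

variable {D : Set ℂ}

namespace Quad

/-! ### Pieces of relabelled quads -/

/-- Pieces only depend on the carrier: `rot`. [folklore] -/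
@[simp] theorem rot_piece (Q : Quad D) (δ : ℝ) (p : Site 2 × Site 2) :
    Q.rot.piece δ p = Q.piece δ p := by
  simp only [piece, rot_carrier]

/-- Pieces only depend on the carrier: `flip`. [folklore] -/
@[simp] theorem flip_piece (Q : Quad D) (δ : ℝ) (p : Site 2 × Site 2) :
    Q.flip.piece δ p = Q.piece δ p := by
  simp only [piece, flip_carrier]

/-! ### Dual crossings cut at their first visit of the free side -/

/-- A dual crossing of `[Q]` (from `∂₀Q` to `∂₂Q`, off the open edges) may be cut at its first
visit of `∂₂Q`: the cut path lands at a point `Q(1, θ)` and meets `∂₂Q` only there.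
[cite: SchrammSmirnov2011, proof of Lemma 6.1] -/
theorem exists_dualPath_firstVisit (Q : Quad D) {δ : ℝ} {ω : BondConfig (Site 2)}
    {β : ℝ → ℂ} (hβc : ContinuousOn β (Icc 0 1)) (hβQ : MapsTo β (Icc 0 1) Q.carrier)
    (hβ0 : β 0 ∈ Q.side 0) (hβ1 : β 1 ∈ Q.side 2)
    (hβO : ∀ t ∈ Icc (0 : ℝ) 1, β t ∉ openEdgeUnion δ ω) :
    ∃ (γ : ℝ → ℂ) (θ : I), ContinuousOn γ (Icc 0 1) ∧ MapsTo γ (Icc 0 1) Q.carrier ∧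
      γ 0 ∈ Q.side 0 ∧ γ 1 = Q (1, θ) ∧ (∀ t ∈ Icc (0 : ℝ) 1, γ t ∉ openEdgeUnion δ ω) ∧
      (∀ t ∈ Ico (0 : ℝ) 1, γ t ∉ Q.side 2) ∧ ∀ t ∈ Icc (0 : ℝ) 1, ∃ s ∈ Icc (0 : ℝ) 1, γ t = β s := by
  set T : Set ℝ := {t | t ∈ Icc (0 : ℝ) 1 ∧ β t ∈ Q.side 2} with hT
  have hTc : IsClosed T := hβc.preimage_isClosed_of_isClosed isClosed_Icc (Q.isCompact_side 2).isClosed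
  have hT1 : (1 : ℝ) ∈ T := ⟨right_mem_Icc.2 zero_le_one, hβ1⟩
  have hTbdd : BddBelow T := ⟨0, fun t ht => ht.1.1⟩
  set tS : ℝ := sInf T with htS
  have htST : tS ∈ T := hTc.csInf_mem ⟨1, hT1⟩ hTbdd
  have htSI : tS ∈ Icc (0 : ℝ) 1 := htST.1
  have htS2 : β tS ∈ Q.side 2 := htST.2
  have hbefore : ∀ t ∈ Icc (0 : ℝ) 1, t < tS → β t ∉ Q.side 2 := fun t ht hlt h2 =>
    absurd (csInf_le hTbdd ⟨ht, h2⟩) (not_le.2 hlt)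
  have htS0 : 0 < tS := by
    rcases htSI.1.eq_or_lt with h | h
    · exfalso
      rw [← h] at htS2
      exact Set.disjoint_left.1 (Q.disjoint_side_side_add_two 0) hβ0 htS2
    · exact h
  obtain ⟨hγc, hγ0, hγ1, hγmaps⟩ := QuadCrossing.exists_reparam hβc le_rfl htS0.le htSI.2
  have hγI : ∀ t ∈ Icc (0 : ℝ) 1, 0 + t * (tS - 0) ∈ Icc (0 : ℝ) 1 := fun t ht =>
    let h := hγmaps t ht; ⟨h.1, h.2.trans htSI.2⟩
  obtain ⟨θ, hθ⟩ : ∃ θ : I, β tS = Q (1, θ) := by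
    obtain ⟨⟨s₀, θ⟩, hs, hsy⟩ := (show β tS ∈ Q '' {z : I × I | z.1 = 1} from htS2)
    simp only [mem_setOf_eq] at hs
    subst hs
    exact ⟨θ, hsy.symm⟩
  refine ⟨fun t => β (0 + t * (tS - 0)), θ, hγc, fun t ht => hβQ (hγI t ht), by rw [hγ0]; exact hβ0,
    by rw [hγ1]; exact hθ, fun t ht => hβO _ (hγI t ht), fun t ht => ?_, fun t ht => ⟨_, hγI t ht, rfl⟩⟩
  refine hbefore _ (hγI t ⟨ht.1, ht.2.le⟩) ?_
  have : 0 + t * (tS - 0) = t * tS := by ring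
  rw [this]
  nlinarith [ht.2, htS0]

/-- **The two wall points of the dual picture are ordered**: if `[Q]` has a dual crossing, then the
top contact `θ_C` of the bottom cluster is at most `1 - θ_C(flip Q)` (one minus the top contact of
the bottom cluster of the flipped quad, i.e. the bottom contact of the top cluster): every first-visit
dual landing lies between them. [cite: SchrammSmirnov2011, proof of Lemma 6.1, case (3)] -/
theorem topContact_le_one_sub_topContact_flip (Q : Quad D) {δ : ℝ} (hδ : 0 < δ)
    {ω : BondConfig (Site 2)}
    (htame : ∀ p : Site 2 × Site 2, (zdGraph 2).Adj p.1 p.2 → IsPreconnected (Q.piece δ p))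
    (hdual : ∃ β : ℝ → ℂ, ContinuousOn β (Icc 0 1) ∧ MapsTo β (Icc 0 1) Q.carrier ∧ β 0 ∈ Q.side 0 ∧
      β 1 ∈ Q.side 2 ∧ ∀ t ∈ Icc (0 : ℝ) 1, β t ∉ openEdgeUnion δ ω) :
    Q.topContact δ ω ≤ 1 - Q.flip.topContact δ ω := by
  obtain ⟨β, hβc, hβQ, hβ0, hβ1, hβO⟩ := hdual
  obtain ⟨γ, θ, hγc, hγQ, hγ0, hγ1, hγO, hfirst, -⟩ := Q.exists_dualPath_firstVisit hβc hβQ hβ0 hβ1 hβO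
  have h1 : Q.topContact δ ω ≤ θ := topContact_le_of_dualPath hδ htame hγc hγQ hγ0 hγO hγ1 hfirst
  -- the same path in the flipped quad lands at parameter `σ θ`
  have hγQ' : MapsTo γ (Icc 0 1) Q.flip.carrier := by rw [flip_carrier]; exact hγQ
  have hγ0' : γ 0 ∈ Q.flip.side 0 := by rw [flip_side_zero]; exact hγ0
  have hγ1' : γ 1 = Q.flip (1, σ θ) := by
    rw [flip_apply]
    show γ 1 = Q (1, σ (σ θ))
    rw [unitInterval.symm_symm]; exact hγ1
  have hfirst' : ∀ t ∈ Ico (0 : ℝ) 1, γ t ∉ Q.flip.side 2 := by rw [flip_side_two]; exact hfirst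
  have h2 : Q.flip.topContact δ ω ≤ σ θ := topContact_le_of_dualPath hδ
    (fun p hp => by rw [flip_piece]; exact htame p hp) hγc hγQ' hγ0' hγO hγ1' hfirst'
  rw [unitInterval.coe_symm_eq] at h2
  linarith

end Quad

/-! ### The tame theorem for case (3), product form -/

/-- **Schramm–Smirnov Lemma 6.1, case (3), main regime, tame pairs — product form at the level of
`P_{1/2}`** (see the module docstring): there are `α, C, c > 0` such that for every pair `(Q, Q')`
satisfying condition (3) at scale `ρ` with `K ρ ≤ c · d₀(Q)` and `ρ < d₁(Q)`, lattice tameness of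
`[Q]` and of `[Q']` at the meshes in play, the `K`-chord–arc property of `∂₃Q'` (written on `rot Q'`)
and the cut `ζ`, for every mesh `η < ρ`,
`P(⊞_Q Δ ⊞_{Q'}) ≤ 2 (C K ρ / d₀(Q))^α · P(dual crossing of rot Q' at mesh η√2)`.
[cite: SchrammSmirnov2011, Lemma 6.1 (3) and its proof, p. 23, via (2), eq. (6.2)–(6.4)] -/
theorem measureReal_symmDiff_le_mul_of_isPerturbationThree_of_tame :
    ∃ α C c : ℝ, 0 < α ∧ 0 < C ∧ 0 < c ∧
      ∀ (D : Set ℂ) (Q Q' : Quad D) (ρ K : ℝ), 0 < ρ → 1 ≤ K → K * ρ ≤ c * Q.sideDist 0 →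
        ρ < Q.sideDist 1 → Q.IsPerturbationThree Q' ρ →
        (∀ η : ℝ, 0 < η → η < ρ → ∀ a b : Site 2, (zdGraph 2).Adj a b →
          IsPreconnected (segment ℝ (meshPoint (η * Real.sqrt 2) a) (meshPoint (η * Real.sqrt 2) b) ∩
            Q.carrier)) →
        (∀ η : ℝ, 0 < η → η < ρ → ∀ p : Site 2 × Site 2, (zdGraph 2).Adj p.1 p.2 →
          IsPreconnected (Q'.piece (η * Real.sqrt 2) p)) →
        (∀ s t : I, dist (Q'.rot (1, s)) (Q'.rot (1, t)) ≤ ρ → ∀ u : I,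
          ((s : ℝ) ≤ u ∧ (u : ℝ) ≤ t ∨ (t : ℝ) ≤ u ∧ (u : ℝ) ≤ s) →
            dist (Q'.rot (1, u)) (Q'.rot (1, s)) ≤ K * ρ) →
        (∃ ζ : ℝ, (∀ t : I, (t : ℝ) ≤ ζ → ∀ y ∈ Q.side 0, ∀ p : Path (Q'.rot (1, t)) y,
            range p ⊆ Q.carrier → Q.sideDist 0 / 4 ≤ Metric.diam (range p)) ∧
          (∀ t : I, ζ ≤ (t : ℝ) → ∀ y ∈ Q.side 2, ∀ p : Path (Q'.rot (1, t)) y,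
            range p ⊆ Q.carrier → Q.sideDist 0 / 4 ≤ Metric.diam (range p))) →
        ∀ η : ℝ, 0 < η → η < ρ →
          (bondPercolation (zdGraph 2) half).real
              (symmDiff {ω | Q ∈ z2QuadConfig D (η * Real.sqrt 2) ω}
                {ω | Q' ∈ z2QuadConfig D (η * Real.sqrt 2) ω}) ≤
            2 * ((C * K * ρ) / Q.sideDist 0) ^ α *
              (bondPercolation (zdGraph 2) half).real
                {ω | ∃ β : ℝ → ℂ, ContinuousOn β (Icc 0 1) ∧ MapsTo β (Icc 0 1) Q'.carrier ∧
                  β 0 ∈ Q'.side 1 ∧ β 1 ∈ Q'.side 3 ∧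
                  ∀ t ∈ Icc (0 : ℝ) 1, β t ∉ openEdgeUnion (η * Real.sqrt 2) ω} := by
  obtain ⟨α, c₀, hα, hc₀, hRSW⟩ := annulusOpenCrossing_half_le_holds
  set C₁ : ℝ := 10 + 2 * c₀ with hC₁
  have hC₁pos : 0 < C₁ := by rw [hC₁]; linarith
  refine ⟨α, 16 * C₁, 1 / (200 * (C₁ + 1)), hα, by positivity, by positivity, ?_⟩
  intro D Q Q' ρ K hρ hK hρc hρ1 h3 htame htame' harc hcut η hη hηρ
  set R := Q.rot with hRdef
  set R' := Q'.rot with hR'def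
  have h2R : R.IsPerturbationTwo R' ρ := (Quad.isPerturbationThree_iff_rot Q Q' ρ).1 h3
  have h2R' := h2R
  obtain ⟨hcar, h0, h1, h3', hjoin⟩ := h2R
  set d := Q.sideDist 0 with hd_def
  have hdpos : 0 < d := Q.sideDist_pos 0
  have hdR : R.sideDist 1 = d := Q.rot_sideDist_one
  have hd0R : R.sideDist 0 = Q.sideDist 1 := Q.rot_sideDist_zero
  have hKpos : 0 < K := by linarith
  have hKρ : ρ ≤ K * ρ := by nlinarith
  have hkρ : 0 < K * ρ := by positivity
  -- the regime
  have hρd : 200 * (C₁ + 1) * (K * ρ) ≤ d := by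
    have := hρc
    rw [div_mul_eq_mul_div, one_mul, le_div_iff₀ (by positivity)] at this
    linarith
  have hCk : 0 ≤ C₁ * (K * ρ) := by positivity
  have hc₀k : 0 ≤ c₀ * (K * ρ) := by positivity
  have hk200 : 200 * (K * ρ) ≤ d := by linarith
  -- the frame of `R'` (mesh `δ' = η √2`)
  have hsqrt2 : Real.sqrt 2 < 2 := by
    rw [show (2 : ℝ) = Real.sqrt 4 by rw [show (4 : ℝ) = 2 ^ 2 by norm_num, Real.sqrt_sq (by norm_num)]]
    exact Real.sqrt_lt_sqrt (by norm_num) (by norm_num)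
  obtain ⟨Φ, hΦ, hΦδ, hΦa, hΦb, hΦc, hΦd, hG⟩ :=
    R'.exists_frame_charts' (mul_pos hη (Real.sqrt_pos.2 (by norm_num)) : 0 < η * Real.sqrt 2)
  have hδ'pos : 0 < Φ.δ := Φ.hδ
  have hδ'ρ : Φ.δ < 2 * ρ := by
    rw [hΦδ]
    calc η * Real.sqrt 2 < ρ * 2 := mul_lt_mul'' hηρ hsqrt2 hη.le (Real.sqrt_nonneg _)
      _ = 2 * ρ := by ring
  have hδ'k : Φ.δ ≤ 2 * (K * ρ) := by linarith
  have htameR : ∀ a b : Site 2, (zdGraph 2).Adj a b →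
      IsPreconnected (segment ℝ (meshPoint Φ.δ a) (meshPoint Φ.δ b) ∩ R.carrier) := by
    rw [hΦδ, hRdef, Quad.rot_carrier]; exact htame η hη hηρ
  have htameR' : ∀ p : Site 2 × Site 2, (zdGraph 2).Adj p.1 p.2 →
      IsPreconnected (R'.piece Φ.δ p) := fun p hp => by
    rw [hΦδ, hR'def, Quad.rot_piece]; exact htame' η hη hηρ p hp
  have hΦT : Φ.flipFrame.Charts R'.flip := SSContinuity.Frame.Charts.flipFrame Φ hΦ
  have hGT := Φ.flipFrame_chart (Q' := R') hG
  -- Step 1: the discrete events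
  rw [← hΦδ]
  set μ := bondPercolation (zdGraph 2) half with hμ
  set A : Set (BondConfig (Site 2)) := {ω | Q ∈ z2QuadConfig D Φ.δ ω} with hA
  set B : Set (BondConfig (Site 2)) := {ω | Q' ∈ z2QuadConfig D Φ.δ ω} with hB
  set Bd : Set (BondConfig (Site 2)) := {ω | ∃ β : ℝ → ℂ, ContinuousOn β (Icc 0 1) ∧
      MapsTo β (Icc 0 1) R'.carrier ∧ β 0 ∈ R'.side 0 ∧ β 1 ∈ R'.side 2 ∧
      ∀ t ∈ Icc (0 : ℝ) 1, β t ∉ openEdgeUnion Φ.δ ω} with hBd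
  have hBdQ' : Bd = {ω | ∃ β : ℝ → ℂ, ContinuousOn β (Icc 0 1) ∧ MapsTo β (Icc 0 1) Q'.carrier ∧
      β 0 ∈ Q'.side 1 ∧ β 1 ∈ Q'.side 3 ∧ ∀ t ∈ Icc (0 : ℝ) 1, β t ∉ openEdgeUnion Φ.δ ω} := by
    simp only [hBd, hR'def, Quad.rot_carrier, Quad.rot_side_zero, Quad.rot_side_two]
  have hBA : B ⊆ A := fun ω hω => by
    rw [hB, mem_setOf_eq, mem_z2QuadConfig_iff_exists_isCrossing hδ'pos] at hω
    obtain ⟨K₀, hK₀, hK₀O⟩ := hω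
    rw [hA, mem_setOf_eq, mem_z2QuadConfig_iff_exists_isCrossing hδ'pos]
    obtain ⟨hcar3, h03, -, h23, -⟩ := h3
    exact ⟨K₀, Quad.IsCrossing.of_subquad hcar3 h03 h23 hK₀, hK₀O⟩
  -- the dual picture on the bad event
  set c₃ : ℝ := d / 4 with hc₃
  set Ea : Set (BondConfig (Site 2)) := {ω | (∃ β : ℝ → ℂ, ContinuousOn β (Icc 0 1) ∧
      MapsTo β (Icc 0 1) R'.carrier ∧ β 0 ∈ R'.side 0 ∧ β 1 ∈ R'.side 2 ∧
        ∀ t ∈ Icc (0 : ℝ) 1, β t ∉ openEdgeUnion Φ.δ ω) ∧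
      (∃ Kset : Set ℂ, IsCompact Kset ∧ IsConnected Kset ∧ Kset ⊆ R.carrier ∧
        Kset ⊆ openEdgeUnion Φ.δ ω ∧ (Kset ∩ R.side 1).Nonempty ∧ (Kset ∩ R.side 3).Nonempty) ∧
      ∀ t ∈ R.side 3, ∀ p : Path (R'.dualWallPt Φ.δ ω) t, range p ⊆ R.carrier →
        c₃ ≤ Metric.diam (range p)} with hEa
  set Eb : Set (BondConfig (Site 2)) := {ω | (∃ β : ℝ → ℂ, ContinuousOn β (Icc 0 1) ∧
      MapsTo β (Icc 0 1) R'.flip.carrier ∧ β 0 ∈ R'.flip.side 0 ∧ β 1 ∈ R'.flip.side 2 ∧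
        ∀ t ∈ Icc (0 : ℝ) 1, β t ∉ openEdgeUnion Φ.flipFrame.δ ω) ∧
      (∃ Kset : Set ℂ, IsCompact Kset ∧ IsConnected Kset ∧ Kset ⊆ R.flip.carrier ∧
        Kset ⊆ openEdgeUnion Φ.flipFrame.δ ω ∧ (Kset ∩ R.flip.side 1).Nonempty ∧
        (Kset ∩ R.flip.side 3).Nonempty) ∧
      ∀ t ∈ R.flip.side 3, ∀ p : Path (R'.flip.dualWallPt Φ.flipFrame.δ ω) t,
        range p ⊆ R.flip.carrier → c₃ ≤ Metric.diam (range p)} with hEb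
  obtain ⟨ζ, hcut₀, hcut₂⟩ := hcut
  -- Step 2: the dichotomy `A ∖ B ⊆ Ea ∪ Eb`
  have hsplit : symmDiff A B ⊆ Ea ∪ Eb := by
    intro ω hω
    have hωA : ω ∈ A := by
      rcases (Set.mem_symmDiff).1 hω with ⟨hωA, -⟩ | ⟨hωB, -⟩
      · exact hωA
      · exact hBA hωB
    have hωB : ω ∉ B := by
      rcases (Set.mem_symmDiff).1 hω with ⟨-, hnB⟩ | ⟨hωB, hnA⟩
      · exact hnB
      · exact absurd (hBA hωB) hnA
    rw [hA, mem_setOf_eq, mem_z2QuadConfig_iff_exists_isCrossing hδ'pos] at hωA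
    rw [hB, mem_setOf_eq, mem_z2QuadConfig_iff_exists_isCrossing hδ'pos] at hωB
    obtain ⟨⟨β, hβc, hβQ, hβ0, hβ1, hβO⟩, hnodual⟩ :=
      Quad.crossed_and_not_crossed_subset_dual_rot Q Q' hδ'pos hωA hωB
    have hβO' : ∀ t ∈ Icc (0 : ℝ) 1, β t ∉ openEdgeUnion Φ.δ ω := fun t ht => (hβO t ht).1
    have hdual : ∃ β : ℝ → ℂ, ContinuousOn β (Icc 0 1) ∧ MapsTo β (Icc 0 1) R'.carrier ∧
        β 0 ∈ R'.side 0 ∧ β 1 ∈ R'.side 2 ∧ ∀ t ∈ Icc (0 : ℝ) 1, β t ∉ openEdgeUnion Φ.δ ω :=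
      ⟨β, hβc, hβQ, hβ0, hβ1, hβO'⟩
    have hKop := R.exists_openCrossing_transversal_of_not_exists_path hδ'pos (fun ⟨γ, hγc, hγm, hγ0, hγ1, hγO⟩ =>
      hnodual ⟨γ, hγc, hγm, hγ0, hγ1, fun t ht => (hγO t ht).1⟩)
    -- the two wall parameters
    set θC : ℝ := R'.topContact Φ.δ ω with hθC
    have horder : θC ≤ 1 - R'.flip.topContact Φ.δ ω :=
      R'.topContact_le_one_sub_topContact_flip hδ'pos htameR' hdual
    by_cases hlow : θC ≤ ζ
    · left
      refine ⟨hdual, hKop, fun t ht p hp => ?_⟩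
      have ht0 : t ∈ Q.side 0 := by rw [hRdef, Quad.rot_side_three] at ht; exact ht
      have hp' : range p ⊆ Q.carrier := by rw [hRdef, Quad.rot_carrier] at hp; exact hp
      have := hcut₀ ⟨θC, Quad.topContact_mem_Icc⟩ hlow t ht0 p hp'
      rw [hc₃]; exact this
    · right
      push Not at hlow
      refine ⟨?_, ?_, fun t ht p hp => ?_⟩
      · obtain ⟨β', hβ'c, hβ'Q, hβ'0, hβ'1, hβ'O⟩ := hdual
        exact ⟨β', hβ'c, by rw [Quad.flip_carrier]; exact hβ'Q, by rw [Quad.flip_side_zero]; exact hβ'0,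
          by rw [Quad.flip_side_two]; exact hβ'1, hβ'O⟩
      · obtain ⟨Kset, hKc, hKconn, hKQ, hKO, hK1, hK3⟩ := hKop
        exact ⟨Kset, hKc, hKconn, by rw [Quad.flip_carrier]; exact hKQ, hKO,
          by rw [Quad.flip_side_one]; exact hK3, by rw [Quad.flip_side_three]; exact hK1⟩
      · -- the flipped wall point `R'(1, σ θCf)` with `σ θCf ≥ θC > ζ`: far from `∂₂Q`
        set θCf : ℝ := R'.flip.topContact Φ.flipFrame.δ ω with hθCf
        have hθCfI : θCf ∈ Icc (0 : ℝ) 1 := Quad.topContact_mem_Icc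
        have hδT : Φ.flipFrame.δ = Φ.δ := by simp
        have hwall : R'.flip.dualWallPt Φ.flipFrame.δ ω = R' (1, σ ⟨θCf, hθCfI⟩) := by
          show R'.flip (1, ⟨R'.flip.topContact Φ.flipFrame.δ ω, _⟩) = _
          rw [Quad.flip_apply]
        have hζ : ζ ≤ ((σ ⟨θCf, hθCfI⟩ : I) : ℝ) := by
          rw [unitInterval.coe_symm_eq]
          show ζ ≤ 1 - θCf
          rw [hθCf, hδT]; linarith
        have ht2 : t ∈ Q.side 2 := by
          rw [Quad.flip_side_three, hRdef, Quad.rot_side_one] at ht; exact ht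
        have hp' : range p ⊆ Q.carrier := by
          rw [Quad.flip_carrier, hRdef, Quad.rot_carrier] at hp; exact hp
        have := hcut₂ (σ ⟨θCf, hθCfI⟩) hζ t ht2 (p.cast hwall.symm rfl) (by rw [Path.cast_coe]; exact hp')
        rw [Path.cast_coe] at this
        rw [hc₃]; exact this
  -- Step 3: the radii and the RSW bound
  set r' : ℝ := max (2 * (K * ρ) + 4 * Φ.δ) (c₀ * Φ.δ) with hr'
  set Rout : ℝ := c₃ / 2 - 4 * (K * ρ) - Φ.δ with hRout
  have hc₀δ : c₀ * Φ.δ ≤ c₀ * (2 * (K * ρ)) := mul_le_mul_of_nonneg_left hδ'k hc₀.le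
  have hr'le : r' ≤ C₁ * (K * ρ) := by
    rw [hr', max_le_iff, hC₁]
    constructor
    · linarith
    · linarith
  have hr'0 : 0 < r' := lt_of_lt_of_le (by positivity) (le_max_left _ _)
  have hRge : d / 16 ≤ Rout := by rw [hRout, hc₃]; linarith
  have hc₃big : 12 * (K * ρ) + 6 * Φ.δ < c₃ := by rw [hc₃]; linarith
  have h2r : 2 * r' ≤ Rout := by linarith
  set ηb : ℝ := (r' / Rout) ^ α with hηb
  have hηb0 : 0 ≤ ηb := Real.rpow_nonneg (div_nonneg hr'0.le (by linarith)) _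
  have hRSW' : ∀ x : ℂ, μ.real (annulusOpenCrossing x Φ.δ (2 * (K * ρ) + 4 * Φ.δ) Rout) ≤ ηb := by
    intro x
    have hsub : annulusOpenCrossing x Φ.δ (2 * (K * ρ) + 4 * Φ.δ) Rout ⊆
        annulusOpenCrossing x Φ.δ r' Rout :=
      SSContinuity.annulusOpenCrossing_mono_left x Φ.δ (by rw [hr']; exact le_max_left _ _) Rout
    refine (measureReal_mono hsub (measure_ne_top _ _)).trans ?_
    exact hRSW x Φ.δ r' Rout hδ'pos (by rw [hr']; exact le_max_right _ _) h2r
  -- Step 4: the two decoupling bounds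
  have hEa : μ.real Ea ≤ ηb * μ.real Bd := by
    have := SSContinuity.Frame.Charts.measureReal_dual_far_le hΦ hΦb hΦc hΦd hG hcar h0 h1 h3' hρ
      (by rw [hd0R]; exact hρ1) hjoin htameR htameR' hK harc hc₃big hηb0 hRSW'
    exact this
  have hEb : μ.real Eb ≤ ηb * μ.real Bd := by
    obtain ⟨hcarT, h0T, h1T, h3T, hjoinT⟩ := Quad.IsPerturbationTwo.flip h2R'
    have hρ0T : ρ < R.flip.sideDist 0 := by rw [Quad.flip_sideDist_zero, hd0R]; exact hρ1
    have htameT : ∀ a b : Site 2, (zdGraph 2).Adj a b →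
        IsPreconnected (segment ℝ (meshPoint Φ.flipFrame.δ a) (meshPoint Φ.flipFrame.δ b) ∩
          R.flip.carrier) := by
      rw [Quad.flip_carrier]; exact htameR
    have htameT' : ∀ p : Site 2 × Site 2, (zdGraph 2).Adj p.1 p.2 →
        IsPreconnected (R'.flip.piece Φ.flipFrame.δ p) := fun p hp => by
      rw [Quad.flip_piece]; exact htameR' p hp
    have hc₃T : 12 * (K * ρ) + 6 * Φ.flipFrame.δ < c₃ := hc₃big
    have hRSWT : ∀ x : ℂ, μ.real (annulusOpenCrossing x Φ.flipFrame.δ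
        (2 * (K * ρ) + 4 * Φ.flipFrame.δ) (c₃ / 2 - 4 * (K * ρ) - Φ.flipFrame.δ)) ≤ ηb := hRSW'
    have := SSContinuity.Frame.Charts.measureReal_dual_far_le hΦT (by simp [hΦb]) (by simp [hΦd])
      (by simp [hΦc]) hGT hcarT h0T h1T h3T hρ hρ0T hjoinT htameT htameT' hK (Quad.flip_arc harc)
      hc₃T hηb0 hRSWT
    have hBT : {ω | ∃ β : ℝ → ℂ, ContinuousOn β (Icc 0 1) ∧ MapsTo β (Icc 0 1) R'.flip.carrier ∧
        β 0 ∈ R'.flip.side 0 ∧ β 1 ∈ R'.flip.side 2 ∧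
        ∀ t ∈ Icc (0 : ℝ) 1, β t ∉ openEdgeUnion Φ.flipFrame.δ ω} = Bd := by
      simp only [hBd, Quad.flip_carrier, Quad.flip_side_zero, Quad.flip_side_two,
        SSContinuity.Frame.flipFrame_δ]
    rw [hBT] at this
    exact this
  -- Step 5: assemble
  have hmono : μ.real (symmDiff A B) ≤ μ.real (Ea ∪ Eb) :=
    measureReal_mono hsplit (measure_ne_top _ _)
  refine hmono.trans ((measureReal_union_le Ea Eb).trans ?_)
  rw [← hBdQ']
  have hbase : r' / Rout ≤ 16 * C₁ * (K * ρ) / d := by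
    rw [div_le_div_iff₀ (by linarith) hdpos]
    calc r' * d ≤ C₁ * (K * ρ) * d := mul_le_mul_of_nonneg_right hr'le hdpos.le
      _ = 16 * C₁ * (K * ρ) * (d / 16) := by ring
      _ ≤ 16 * C₁ * (K * ρ) * Rout := by
          apply mul_le_mul_of_nonneg_left hRge; positivity
  have hpow : ηb ≤ (16 * C₁ * (K * ρ) / d) ^ α :=
    Real.rpow_le_rpow (div_nonneg hr'0.le (by linarith)) hbase hα.le
  have heq : (16 * C₁ * K * ρ) / d = 16 * C₁ * (K * ρ) / d := by ring
  rw [heq]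
  have hB0 : 0 ≤ μ.real Bd := measureReal_nonneg
  have : ηb * μ.real Bd ≤ (16 * C₁ * (K * ρ) / d) ^ α * μ.real Bd :=
    mul_le_mul_of_nonneg_right hpow hB0
  linarith

end QuadCrossing

end Literature.Probability.Percolation
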